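import Literature.ModelTheory.PseudofiniteFields.TriangularChartFibres

/-!
# Stub H8 of line LonelyTranslates (c1): fibres of a triangular chart over its free coordinates
are finite

Crux `PairwiseCurvedTilingsLC` (route DefinableSTPPDichotomy, stmt-MatrixMultiplication-17883),
negative line LonelyTranslates, continuation c1 ("Prop27Reduction").  The registered stub
`stub_finite_chart_fibre` is the `K : Type` case of
`Literature/ModelTheory/PseudofiniteFields/TriangularChartFibres.lean`
(`finite_triangularChart_fibre`): for triangular equations `D_j(u, w) = 0` (`∂D_j/∂w_i = 0` for
`i < j`) over a field and a fixed value `u` of the free coordinates, the set of bound coordinates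
`w` with `D(u, w) = 0` and `(∂D_j/∂w_j)(u, w) ≠ 0` for all `j` is finite (nonsingular zeros of the
square system `D_j(u, ·)`, whose Jacobian determinant is `∏_j ∂D_j/∂w_j` by triangularity;
`finite_nonsingular_zeros`).  It is consumed by Case 2 of the chart induction (`stub_openPiece`)
of the skeleton: the `(u, t)`-projection of the definable set has finite fibres.
-/

set_option linter.dupNamespace false  -- `Summit.<S>.<S>.…` is the mandated namespace

namespace Summit.MatrixMultiplication.MatrixMultiplication.Theorems.PairwiseCurvedTilingsLC.Negative

open FirstOrder FirstOrder.Language FirstOrder.Ring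
open Literature.ModelTheory.PseudofiniteFields

/-- STUB (helper H8): over a fixed value `u` of the free coordinates, a triangular chart
`{D_j(u, w) = 0, ∂D_j/∂w_j ≠ 0}` (`∂D_j/∂w_i = 0` for `i < j`) has only finitely many points `w`
(`finite_triangularChart_fibre`). -/
theorem stub_finite_chart_fibre {K : Type} [Field K] {e k : ℕ}
    (D : Fin k → MvPolynomial (Fin e ⊕ Fin k) K)
    (htri : ∀ j i : Fin k, i < j → MvPolynomial.pderiv (Sum.inr i) (D j) = 0) (u : Fin e → K) :
    {w : Fin k → K | (∀ j, MvPolynomial.eval (Sum.elim u w) (D j) = 0) ∧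
      ∀ j, MvPolynomial.eval (Sum.elim u w) (MvPolynomial.pderiv (Sum.inr j) (D j)) ≠ 0}.Finite :=
  finite_triangularChart_fibre D htri u

end Summit.MatrixMultiplication.MatrixMultiplication.Theorems.PairwiseCurvedTilingsLC.Negative
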